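import Summits.QuantumFields.GaugeBoot.BootstrapReflectionFamiliesZd
import Summits.QuantumFields.GaugeBoot.ClassBIdentification
import Literature.MathematicalPhysics.QuantumLattice.LatticeGaugeDLRGibbsProofs
import Literature.MathematicalPhysics.QuantumLattice.LatticeGaugeDLRLimitPointsProofs
import HarnessLib

/-!
# Reflection-positivity cuts of the infinite-lattice bootstrap: sound for the reflection-positive phases and for every thermodynamic limit point of the torus states (gauge-boot, L1/L4 supplement)

HONEST FRAMING (cell `pub-gaugeboot`, page 1 of every file): the venture produces certified bounds
on lattice expectations at stated coupling, gauge group, dimension and torus size; NOT a mass gap,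
NOT a continuum limit, NOT a string tension; NOT Yang–Mills-summit-bearing (barriers
`FixedCouplingUltralocality`, `PerturbativeInvisibility`). Structural; it certifies no number.

## Content (`SU(N)` on `ℤ^d`, one-link Wilson boundary actions, word level `n`)

Kazakov–Zheng's infinite-lattice SDP = loop equations + positivity + the full lattice symmetry
(`fullSymLevelValuesZdSuN`, `BootstrapReflectionsZd`) + REFLECTION-POSITIVITY CUTS: for each mirror,
`φ ((F ∘ Θ) · F) ≥ 0` for the test functions `F` supported in the closed half-space. Here the cuts
for the site mirrors `x_i = 0` and the link mirrors `x_i = ½` (the diagonal mirrors are refuted on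
finite tori, `not_diagonalReflectionPositive`, and open for limit points — `ClassBIdentification`):

* `IsSiteRPCutFunctional r n φ`, `IsLinkRPCutFunctional r n φ` — the cuts for `F` in the degree-`n`
  word space at the half-spaces `siteHalfEdges i` / `linkHalfEdges i`;
* ★★ `integral_comp_mul_nonneg_of_isReflectionPositiveFor` — SOUNDNESS OF ONE CUT: a finite measure
  reflection positive for `(Θ, S)` (`ClassB.IsReflectionPositiveFor`: bounded measurable
  half-observables) gives every word-space element `F` at `S` the cut `0 ≤ ∫ (F ∘ Θ) F dμ`;
* ★ `rpFullSymLevelValuesZdSuN N β n P` — THE LEVEL-`n` SDP WITH EVERYTHING: feasible, invariant on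
  the words of length `≤ 2n` under translations, axis permutations, axis reflections, AND site- and
  link-RP cuts at degree `n`; `⊆ fullSym`; antitone in `n`;
* ★★ `dlr_integral_mem_rpFullSymLevelValuesZd` — SOUND for every Gibbs state with the full lattice
  symmetry which is site- and link-reflection positive;
* ★★★ `integral_mem_rpFullSymLevelValuesZd_of_mem_infiniteVolumeLimitPoints` — `β ≥ 0`: EVERY
  THERMODYNAMIC LIMIT POINT of the torus Wilson states is feasible for the full KZ SDP at EVERY level
  (limit points are DLR, fully symmetric, site- and link-RP: `ClassBLimitSymmetry`,
  `ClassBIdentification`); ★★ `rpFullSymLevelValuesZd_nonempty` (`β ≥ 0`): the full SDP is feasible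
  at every level, and a certified bound from it bounds the plaquette of every torus limit point.

What this is NOT: the converse limit statement (that the RP-cut hierarchy converges to EXACTLY the
RP symmetric Gibbs states needs "RP on polynomial half-observables ⇒ RP", an `L²` closure as in
`ClassBRPClosure` — not done here); diagonal RP cuts; `β < 0`; anything numerical.

References: V. Kazakov, Z. Zheng, arXiv:2203.11360 §3.1–3.3, arXiv:2404.16925 §3.2; K. Osterwalder,
E. Seiler, Ann. Phys. 110 (1978) 440. Folklore.
-/

noncomputable section

open MeasureTheory
open scoped ComplexOrder ComplexConjugate
open Literature.MathematicalPhysics.QuantumFieldTheory (LatticeRep)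
open Literature.Probability.LatticeModels (Site)
open Literature.MathematicalPhysics.QuantumLattice

namespace Summit.QuantumFields.GaugeBoot

/-! ## The cuts -/

section Cuts

variable {d : ℕ} {G : Type*} [Group G] [TopologicalSpace G] [IsTopologicalGroup G] (r : LatticeRep G)

/-- **Site reflection-positivity cuts at degree `n`**: `0 ≤ φ ((F ∘ Θ_i) F)` for every `F` in the
degree-`n` word space at the closed half-space `x_i ≥ 0` and every axis `i`. [folklore] -/
def IsSiteRPCutFunctional (n : ℕ) (φ : C(LGConfig d G, ℝ) →ₗ[ℝ] ℝ) : Prop :=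
  ∀ (i : Fin d), ∀ F ∈ wordSpace r (siteHalfEdges i) n,
    0 ≤ φ (F.comp (zdSiteReflectCM (G := G) i) * F)

/-- **Link reflection-positivity cuts at degree `n`**: the same for the mirrors `x_i = ½`, the
half-space `x_i ≥ 1` and the link reflection `zdLinkReflectCM i`. [folklore] -/
def IsLinkRPCutFunctional (n : ℕ) (φ : C(LGConfig d G, ℝ) →ₗ[ℝ] ℝ) : Prop :=
  ∀ (i : Fin d), ∀ F ∈ wordSpace r (linkHalfEdges i) n,
    0 ≤ φ (F.comp (zdLinkReflectCM (G := G) i) * F)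

/-- Fewer test functions at lower degree (site). -/
theorem IsSiteRPCutFunctional.mono {m n : ℕ} (hmn : m ≤ n) {φ : C(LGConfig d G, ℝ) →ₗ[ℝ] ℝ}
    (h : IsSiteRPCutFunctional r n φ) : IsSiteRPCutFunctional r m φ :=
  fun i F hF => h i F (wordSpace_mono r subset_rfl hmn hF)

/-- Fewer test functions at lower degree (link). -/
theorem IsLinkRPCutFunctional.mono {m n : ℕ} (hmn : m ≤ n) {φ : C(LGConfig d G, ℝ) →ₗ[ℝ] ℝ}
    (h : IsLinkRPCutFunctional r n φ) : IsLinkRPCutFunctional r m φ :=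
  fun i F hF => h i F (wordSpace_mono r subset_rfl hmn hF)

variable [CompactSpace G] [MeasurableSpace G] [BorelSpace G] [SecondCountableTopology G]

omit [IsTopologicalGroup G] in
/-- ★★ **Soundness of one cut.** A finite measure reflection positive for `(Θ, S)` in the sense of
`ClassB.IsReflectionPositiveFor` (bounded measurable half-observables, complex form) gives every
element `F` of a word space at `S` the real cut `0 ≤ ∫ (F ∘ Θ) · F dμ`. [cite:
OsterwalderSeiler1978, §2] -/
theorem integral_comp_mul_nonneg_of_isReflectionPositiveFor {Θ : LGConfig d G → LGConfig d G}
    {S : Set (ZdEdge d)} {μ : Measure (LGConfig d G)} (hμ : IsReflectionPositiveFor Θ S μ)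
    (ΘCM : C(LGConfig d G, LGConfig d G)) (hΘ : ∀ U, ΘCM U = Θ U) {n : ℕ} {F : C(LGConfig d G, ℝ)}
    (hF : F ∈ wordSpace r S n) : 0 ≤ ∫ U, (F.comp ΘCM * F) U ∂μ := by
  have h := hμ (fun U => (F U : ℂ)) (Complex.continuous_ofReal.comp F.continuous).measurable
    ⟨‖F‖, fun U => by rw [Complex.norm_real]; exact F.norm_coe_le_norm U⟩
    (fun _ _ hUV => congrArg (fun x : ℝ => (x : ℂ)) (apply_eq_of_mem_wordSpace r hF hUV))
  have hre : ∫ U, (starRingEnd ℂ) ((F (Θ U) : ℝ) : ℂ) * (F U : ℂ) ∂μ = ((∫ U, F (Θ U) * F U ∂μ : ℝ) : ℂ) := by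
    simp only [Complex.conj_ofReal, ← Complex.ofReal_mul]
    exact integral_ofReal
  rw [hre, Complex.zero_le_real] at h
  simpa only [ContinuousMap.mul_apply, ContinuousMap.comp_apply, hΘ] using h

/-- **Soundness of the site cuts** for a site-RP measure. -/
theorem isSiteRPCutFunctional_expectation {μ : Measure (LGConfig d G)} [IsFiniteMeasure μ]
    (h : ∀ i : Fin d, IsReflectionPositiveFor (configSiteReflect (G := G) i) (siteHalfEdges i) μ) (n : ℕ) :
    IsSiteRPCutFunctional r n (expectationFunctional μ) := fun i F hF => by
  rw [expectationFunctional_apply]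
  exact integral_comp_mul_nonneg_of_isReflectionPositiveFor r (h i) _ (zdSiteReflectCM_apply i) hF

/-- **Soundness of the link cuts** for a link-RP measure. -/
theorem isLinkRPCutFunctional_expectation {μ : Measure (LGConfig d G)} [IsFiniteMeasure μ]
    (h : ∀ i : Fin d, IsReflectionPositiveFor (configLinkReflect (G := G) i) (linkHalfEdges i) μ) (n : ℕ) :
    IsLinkRPCutFunctional r n (expectationFunctional μ) := fun i F hF => by
  rw [expectationFunctional_apply]
  exact integral_comp_mul_nonneg_of_isReflectionPositiveFor r (h i) _ (zdLinkReflectCM_apply i) hF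

end Cuts

/-! ## `SU(N)`: the SDP with everything, and its soundness -/

section ZdSuN

variable {d : ℕ} (N : ℕ) (β : ℝ)

/-- ★ **Kazakov–Zheng's infinite-lattice SDP at level `n`** (minus the diagonal RP family):
level-`n` feasible functionals invariant on the words of length `≤ 2n` under translations, axis
permutations and axis reflections, satisfying the site- and link-RP cuts at degree `n`. [folklore] -/
def rpFullSymLevelValuesZdSuN (n : ℕ) (P : C(LGConfig d (Matrix.specialUnitaryGroup (Fin N) ℂ), ℝ)) : Set ℝ :=
  {t | ∃ φ : C(LGConfig d (Matrix.specialUnitaryGroup (Fin N) ℂ), ℝ) →ₗ[ℝ] ℝ,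
    IsBootstrapFeasible (fundamentalLatticeRep N) (suExp N)
        (fun e => wilsonBoundaryAction (fundamentalRep (Fin N)) {e}) β
        (wordTruncation (ι := ZdEdge d) (fundamentalLatticeRep N) n) φ ∧
      (∀ (v : Fin d → ℤ), ∀ x ∈ wordTruncation (ι := ZdEdge d) (fundamentalLatticeRep N) (n + n),
        φ (x.comp (relabelCM (G := Matrix.specialUnitaryGroup (Fin N) ℂ) (edgeShift v))) = φ x) ∧
      (∀ (σ : Equiv.Perm (Fin d)), ∀ x ∈ wordTruncation (ι := ZdEdge d) (fundamentalLatticeRep N) (n + n),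
        φ (x.comp (relabelCM (G := Matrix.specialUnitaryGroup (Fin N) ℂ) (edgePerm σ))) = φ x) ∧
      (∀ (i : Fin d), ∀ x ∈ wordTruncation (ι := ZdEdge d) (fundamentalLatticeRep N) (n + n),
        φ (x.comp (zdSiteReflectCM (G := Matrix.specialUnitaryGroup (Fin N) ℂ) i)) = φ x) ∧
      IsSiteRPCutFunctional (fundamentalLatticeRep N) n φ ∧
      IsLinkRPCutFunctional (fundamentalLatticeRep N) n φ ∧ φ P = t}

/-- The RP cuts shrink the feasible set: `rpFullSym ⊆ fullSym`. -/
theorem rpFullSymLevelValuesZd_subset_fullSym (n : ℕ)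
    (P : C(LGConfig d (Matrix.specialUnitaryGroup (Fin N) ℂ), ℝ)) :
    rpFullSymLevelValuesZdSuN (d := d) N β n P ⊆ fullSymLevelValuesZdSuN (d := d) N β n P := by
  rintro t ⟨φ, hφ, hT, hperm, hrefl, -, -, rfl⟩
  exact ⟨φ, hφ, hT, hperm, hrefl, rfl⟩

/-- **Higher level, fewer values.** -/
theorem rpFullSymLevelValuesZd_anti {m n : ℕ} (hmn : n ≤ m)
    (P : C(LGConfig d (Matrix.specialUnitaryGroup (Fin N) ℂ), ℝ)) :
    rpFullSymLevelValuesZdSuN (d := d) N β m P ⊆ rpFullSymLevelValuesZdSuN (d := d) N β n P := by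
  rintro t ⟨φ, hφ, hT, hperm, hrefl, hsite, hlink, rfl⟩
  exact ⟨φ, hφ.mono (fundamentalLatticeRep N) (wordTruncation_mono _ hmn),
    fun v x hx => hT v x (wordTruncation_mono _ (Nat.add_le_add hmn hmn) hx),
    fun σ x hx => hperm σ x (wordTruncation_mono _ (Nat.add_le_add hmn hmn) hx),
    fun i x hx => hrefl i x (wordTruncation_mono _ (Nat.add_le_add hmn hmn) hx),
    hsite.mono _ hmn, hlink.mono _ hmn, rfl⟩

/-- The symmetry clauses for the expectation functional of a fully symmetric measure. -/
theorem expectationFunctional_fullSym_clauses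
    {μ : Measure (LGConfig d (Matrix.specialUnitaryGroup (Fin N) ℂ))} [IsProbabilityMeasure μ]
    (hT : IsZdTranslationInvariant μ)
    (hperm : ∀ σ : Equiv.Perm (Fin d), μ.map (relabelConfig (edgePerm σ)) = μ)
    (hrefl : ∀ i : Fin d, μ.map (configSiteReflect i) = μ) (W : Set C(LGConfig d (Matrix.specialUnitaryGroup (Fin N) ℂ), ℝ)) :
    (∀ (v : Fin d → ℤ), ∀ x ∈ W,
        expectationFunctional μ (x.comp (relabelCM (G := Matrix.specialUnitaryGroup (Fin N) ℂ) (edgeShift v))) =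
          expectationFunctional μ x) ∧
      (∀ (σ : Equiv.Perm (Fin d)), ∀ x ∈ W,
        expectationFunctional μ (x.comp (relabelCM (G := Matrix.specialUnitaryGroup (Fin N) ℂ) (edgePerm σ))) =
          expectationFunctional μ x) ∧
      (∀ (i : Fin d), ∀ x ∈ W,
        expectationFunctional μ (x.comp (zdSiteReflectCM (G := Matrix.specialUnitaryGroup (Fin N) ℂ) i)) =
          expectationFunctional μ x) := by
  refine ⟨fun v x _ => ?_, fun σ x _ => ?_, fun i x _ => ?_⟩
  · rw [expectationFunctional_apply, expectationFunctional_apply]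
    have hmp : MeasurePreserving (configShift (G := Matrix.specialUnitaryGroup (Fin N) ℂ) (-v)) μ μ :=
      ⟨(configShift _).measurable, hT (-v)⟩
    have h := hmp.integral_comp (configShift (-v)).measurableEmbedding (fun U => x U)
    simp only [ContinuousMap.comp_apply, relabelCM_edgeShift_eq_configShift]
    exact h
  · rw [expectationFunctional_apply, expectationFunctional_apply]
    have hmp : MeasurePreserving
        (relabelConfig (G := Matrix.specialUnitaryGroup (Fin N) ℂ) (edgePerm σ⁻¹)) μ μ :=
      ⟨(relabelConfig _).measurable, hperm σ⁻¹⟩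
    have h := hmp.integral_comp (relabelConfig (edgePerm σ⁻¹)).measurableEmbedding (fun U => x U)
    simp only [ContinuousMap.comp_apply, relabelCM_edgePerm_eq_relabelConfig]
    exact h
  · rw [expectationFunctional_apply, expectationFunctional_apply]
    have hmp : MeasurePreserving (configSiteReflectMeasurableEquiv (d := d) N i) μ μ :=
      ⟨(configSiteReflectMeasurableEquiv N i).measurable, hrefl i⟩
    have h := hmp.integral_comp (configSiteReflectMeasurableEquiv N i).measurableEmbedding (fun U => x U)
    simp only [ContinuousMap.comp_apply, zdSiteReflectCM_apply]
    exact h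

/-- ★★ **Soundness for the reflection-positive fully symmetric phases**: a Gibbs state invariant
under translations, axis permutations and axis reflections which is reflection positive for the
site mirrors and the link mirrors is feasible for the SDP with everything, at every level. [folklore] -/
theorem dlr_integral_mem_rpFullSymLevelValuesZd (n : ℕ)
    {μ : Measure (LGConfig d (Matrix.specialUnitaryGroup (Fin N) ℂ))}
    (hμ : μ ∈ ymGibbsMeasures (d := d) (fundamentalRep (Fin N)) β) (hT : IsZdTranslationInvariant μ)
    (hperm : ∀ σ : Equiv.Perm (Fin d), μ.map (relabelConfig (edgePerm σ)) = μ)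
    (hrefl : ∀ i : Fin d, μ.map (configSiteReflect i) = μ)
    (hsite : ∀ i : Fin d, IsReflectionPositiveFor (configSiteReflect (G := Matrix.specialUnitaryGroup (Fin N) ℂ) i)
      (siteHalfEdges i) μ)
    (hlink : ∀ i : Fin d, IsReflectionPositiveFor (configLinkReflect (G := Matrix.specialUnitaryGroup (Fin N) ℂ) i)
      (linkHalfEdges i) μ)
    (P : C(LGConfig d (Matrix.specialUnitaryGroup (Fin N) ℂ), ℝ)) :
    ∫ U, P U ∂μ ∈ rpFullSymLevelValuesZdSuN (d := d) N β n P := by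
  haveI := hμ.1
  haveI : SecondCountableTopology (Matrix (Fin N) (Fin N) ℂ) :=
    inferInstanceAs (SecondCountableTopology (Fin N → Fin N → ℂ))
  haveI : SecondCountableTopology (Matrix.specialUnitaryGroup (Fin N) ℂ) :=
    Topology.IsEmbedding.subtypeVal.secondCountableTopology
  obtain ⟨h1, h2, h3⟩ := expectationFunctional_fullSym_clauses (d := d) N hT hperm hrefl
    (wordTruncation (ι := ZdEdge d) (fundamentalLatticeRep N) (n + n))
  exact ⟨expectationFunctional μ, isBootstrapFeasible_dlr_suN N β hμ (wordTruncation_subset_polyAlgebra _ n),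
    h1, h2, h3, isSiteRPCutFunctional_expectation (fundamentalLatticeRep N) hsite n,
    isLinkRPCutFunctional_expectation (fundamentalLatticeRep N) hlink n, rfl⟩

/-! ### Every thermodynamic limit point of the torus states is feasible for the SDP with everything -/

/-- `ClassB`'s axis permutation of configurations is the `relabelConfig` by `edgePerm σ`. -/
theorem configPerm_eq_relabelConfig_edgePerm (σ : Equiv.Perm (Fin d))
    (U : LGConfig d (Matrix.specialUnitaryGroup (Fin N) ℂ)) :
    configPerm σ U = relabelConfig (edgePerm σ) U := by
  funext e
  rfl

/-- ★★★ **`β ≥ 0`: every infinite-volume limit point of the torus Wilson states of `SU(N)` is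
feasible for Kazakov–Zheng's full infinite-lattice SDP at every level** — it is a DLR state
(`mem_ymGibbsMeasures_of_mem_infiniteVolumeLimitPoints_holds`), invariant under the full lattice
symmetry (`ClassBLimitSymmetry`), and reflection positive for the site and the link mirrors
(`ClassBIdentification`, from Osterwalder–Seiler positivity of every torus). So a bound certified by
that SDP at any level bounds `∫ P dμ` for every such limit point `μ`. [folklore] -/
theorem integral_mem_rpFullSymLevelValuesZd_of_mem_infiniteVolumeLimitPoints [NeZero d] {β : ℝ} (hβ : 0 ≤ β)
    {μ : Measure (LGConfig d (Matrix.specialUnitaryGroup (Fin N) ℂ))}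
    (hμ : μ ∈ infiniteVolumeLimitPoints (d := d) (fundamentalRep (Fin N)) β) (n : ℕ)
    (P : C(LGConfig d (Matrix.specialUnitaryGroup (Fin N) ℂ), ℝ)) :
    ∫ U, P U ∂μ ∈ rpFullSymLevelValuesZdSuN (d := d) N β n P := by
  haveI : SecondCountableTopology (Matrix (Fin N) (Fin N) ℂ) :=
    inferInstanceAs (SecondCountableTopology (Fin N → Fin N → ℂ))
  haveI : SecondCountableTopology (Matrix.specialUnitaryGroup (Fin N) ℂ) :=
    Topology.IsEmbedding.subtypeVal.secondCountableTopology
  have hρ := continuous_fundamentalRep (Fin N)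
  have hG := mem_ymGibbsMeasures_of_mem_infiniteVolumeLimitPoints_holds (fundamentalRep (Fin N)) hρ hμ
  refine dlr_integral_mem_rpFullSymLevelValuesZd N β n hG
    (isZdTranslationInvariant_of_mem_infiniteVolumeLimitPoints (fundamentalRep (Fin N)) hμ)
    (fun σ => ?_) (fun i => (reflectInvariant_of_mem_infiniteVolumeLimitPoints (fundamentalRep (Fin N)) hρ hμ i).map_eq)
    (siteRP_of_mem_infiniteVolumeLimitPoints (fundamentalRep (Fin N)) hρ hβ hμ)
    (linkRP_of_mem_infiniteVolumeLimitPoints (fundamentalRep (Fin N)) hρ hβ hμ) P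
  have h := (permInvariant_of_mem_infiniteVolumeLimitPoints (fundamentalRep (Fin N)) hρ hμ σ).map_eq
  have he : (configPerm σ : LGConfig d (Matrix.specialUnitaryGroup (Fin N) ℂ) → _) = relabelConfig (edgePerm σ) :=
    funext (configPerm_eq_relabelConfig_edgePerm N σ)
  rwa [he] at h

/-- ★★ **`β ≥ 0`: the SDP with everything is feasible at every level**, witnessed by any
thermodynamic limit point of the torus states. -/
theorem rpFullSymLevelValuesZd_nonempty [NeZero d] {β : ℝ} (hβ : 0 ≤ β) (n : ℕ)
    (P : C(LGConfig d (Matrix.specialUnitaryGroup (Fin N) ℂ), ℝ)) :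
    (rpFullSymLevelValuesZdSuN (d := d) N β n P).Nonempty := by
  haveI : SecondCountableTopology (Matrix (Fin N) (Fin N) ℂ) :=
    inferInstanceAs (SecondCountableTopology (Fin N → Fin N → ℂ))
  haveI : SecondCountableTopology (Matrix.specialUnitaryGroup (Fin N) ℂ) :=
    Topology.IsEmbedding.subtypeVal.secondCountableTopology
  obtain ⟨μ, hμ⟩ := infiniteVolumeLimitPoints_nonempty_holds (d := d) (fundamentalRep (Fin N))
    (continuous_fundamentalRep _) β
  exact ⟨_, integral_mem_rpFullSymLevelValuesZd_of_mem_infiniteVolumeLimitPoints N hβ hμ n P⟩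

/-- ★★ **A bound certified by the SDP with everything bounds every thermodynamic limit point**
(`β ≥ 0`): if every level-`n` value of `P` in `rpFullSymLevelValuesZdSuN` is `≤ c`, then
`∫ P dμ ≤ c` for every infinite-volume limit point `μ` of the torus Wilson states. [folklore] -/
theorem integral_le_of_forall_rpFullSymLevelValuesZd_le [NeZero d] {β : ℝ} (hβ : 0 ≤ β) {n : ℕ}
    {P : C(LGConfig d (Matrix.specialUnitaryGroup (Fin N) ℂ), ℝ)} {c : ℝ}
    (hc : ∀ t ∈ rpFullSymLevelValuesZdSuN (d := d) N β n P, t ≤ c)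
    {μ : Measure (LGConfig d (Matrix.specialUnitaryGroup (Fin N) ℂ))}
    (hμ : μ ∈ infiniteVolumeLimitPoints (d := d) (fundamentalRep (Fin N)) β) : ∫ U, P U ∂μ ≤ c :=
  hc _ (integral_mem_rpFullSymLevelValuesZd_of_mem_infiniteVolumeLimitPoints N hβ hμ n P)

end ZdSuN

end Summit.QuantumFields.GaugeBoot

end
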